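import Summits.AtomisticToContinuum.HydrodynamicLimit.Theorems.BoxDissipativeWeakStrongRelativeEnergyStabilityGronwallExpect
import Summits.AtomisticToContinuum.HydrodynamicLimit.Theorems.BoxDissipativeWeakStrongRelativeEnergyStabilityGronwallBounds
import Summits.AtomisticToContinuum.HydrodynamicLimit.Theorems.BoxDissipativeWeakStrongRelativeEnergyStabilityGronwallMasterConst
import Summits.AtomisticToContinuum.HydrodynamicLimit.Theorems.BoxDissipativeWeakStrongRelativeEnergyStabilityGronwallPathwiseB
import Summits.AtomisticToContinuum.HydrodynamicLimit.Theorems.BoxDissipativeWeakStrongRelativeEnergyStabilityGronwallKMeas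
import Summits.AtomisticToContinuum.HydrodynamicLimit.Theorems.BoxDissipativeWeakStrongRelativeEnergyStabilityGronwallUnpack
import Summits.AtomisticToContinuum.HydrodynamicLimit.Theorems.BoxDissipativeWeakStrongRelativeEnergyStabilityGronwallPrelim
import HarnessLib

/-!
# Crux `RelativeEnergyStability` (stmt-AtomisticToContinuum-17653), line `registered`:
# the heart stub S-X `stub_clampedRelEnergyGronwall` — the clamped relative-energy Grönwall in expectation

This file closes the last registered stub of the line: Březina–Feireisl's weak–strong relative-energy argument
(BrezinaFeireisl2018 §3.2) run IN EXPECTATION over the local Gibbs law `P_N` along the hard-sphere flow, in the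
clamped currency `ℰ_{Z_{a,b}}` of the cut hard-sphere law with a deep lower clamp.

Assembly (all ingredients landed in the `…RelativeEnergyStabilityGronwall*` files of the line):
* thresholds: the band thresholds of the unpacked closure hypotheses K1 (`sx_fluxClosure_velocity`, tested with
  `w := u`) and K2 (`sx_entropyAdmissibility_temperature`, tested with `φ := θ`), of the master inequality (S-M), of the
  coercivity estimate (`co_pointwise_estimate`), the smooth band extension (`cm_band_extension`) and the smallness
  scales of `Z = 1 + ηF'`, `(ηZ)'` at `η = 0` (`sx_smallness`); `σ₀ ≤ 1/2` so that `P_N` is a probability law;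
* the Grönwall function `f_N(t) = E_{P_N} ∫ ℰ_Z(Û_N(πt,x) | (ρ,u,θ)(πt,x)) dx` read through the jointly measurable
  version `Ψ` of the flow (S-J) and the time clamp `π` (measurable in `t`: `sx_measurable_mean`; bounded:
  `sx_obs_abs_le` + the energy moment bound S-E; `f_N(0) → 0`: clamped vanishing at `t = 0` and nonnegativity
  `sx_obs_nonneg` for `N ≥ N₀`, `((N+1)ℓ_N³)⁻¹ ≤ ρs`);
* the integral inequality `f_N(t) ≤ f_N(0) + C∫₀ᵗ f_N + err_N(t)`: the pathwise inequality `sx_pathwise` (a.s.: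
  good data with pairwise distinct velocities at rational times, `sx_ae_rational_distinct`) with the uniform master
  constant `sx_master_constant`, integrated against `P_N` (`sx_integrable_obs`, `sx_integrable_timeIntegral_obs`,
  Fubini `sx_fubini_obs`), with forcing `err_N(t) = E|K1_t| + E K2_t⁺ → 0` (a.e.-measurability `sx_aemeasurable_K1/K2`
  turns the vanishing `lintegral`s of K1/K2 into vanishing Bochner integrals; before the threshold `N₀` or when a
  `lintegral` is infinite the forcing is defined so that the inequality is an identity);
* the forced Grönwall lemma S-G, and back to `∫⁻ ofReal` at time `τ` by nonnegativity.
-/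

noncomputable section

namespace Summit.AtomisticToContinuum.HydrodynamicLimit.Theorems.RES

open MeasureTheory Filter Set Function
open scoped Topology InnerProductSpace ENNReal Classical
open Summit.AtomisticToContinuum.HydrodynamicLimit.Theses.BoxDissipativeWeakStrong
open Literature.MathematicalPhysics.KineticTheory Literature.Analysis.FluidPDE Literature.Analysis.FunctionSpaces
open Literature.Analysis.FluidPDE.CompressibleEuler
open Literature.Analysis.FluidPDE.CompressibleEuler.EulerPhase
open Literature.Analysis.FluidPDE.CompressibleEuler.StrongPointData

/-! ## The heart -/

/-- **S-X — the clamped relative-energy Grönwall in expectation (THE HEART; size L; the lead's stub).**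
Under the forced Grönwall lemma (S-G), the jointly measurable version of the flow (S-J), the balance laws (S-B), the master inequality (S-M), the energy moment bound (S-E), the route's closure
statements `FluxClosure` (K1) and `EntropyAdmissibility` (K2) and the EOS fact there is a band threshold
`ηb > 0` such that for every band `0 < η₁ < ηb`, all continuous positive profiles and `σ < σ₀(profiles)`:
for every classical hard-sphere Euler solution on `[0,T)` with `ρσ³ ≤ η₁/2`, every flow family whose
local-Gibbs fields satisfy the `t = 0` LLN (the hypothesis under which K1/K2 deliver), every kinetic window,
every `τ ∈ [0,T)` and all clamps admissible on `[0,τ]`: clamped vanishing at `0` implies clamped vanishing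
at `τ`. BF18 §3.2 in expectation over `P_N` with zero defect: `d/dt E_P∫ℰ_Z` is assembled from S-B (energy,
continuity with `φ₁ = ½|u|² − μ_cut(ρ,θ)`), K1 tested with `w = u` (momentum), K2 with `φ = θ` and `Z_{a,b}`
(entropy, correct sign) and `∂ₜ p_cut(ρ,θ)`, giving `E_P∫ℰ_Z(τ) ≤ E_P∫ℰ_Z(0) + ∫₀^τ E_P∫ rawRHS + err_N(τ)` with
`err_N(τ) → 0` pointwise and bounded (moment bounds from S-B + S-E); `∫ rawRHS dx = ∫ reducedRHS dx`
(`rawRHS_add_div_eq`, `setIntegral_divPU_eq_zero` for the smooth band extension); S-M a.s. on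
vacuum/quadrant boxes, one-particle frozen boxes by hand, multi-particle frozen boxes Liouville-null;
Grönwall with `o(1)` forcing by dominated convergence. -/
theorem stub_clampedRelEnergyGronwall :
    (∀ (f err : ℕ → ℝ → ℝ) (τ C B : ℝ), 0 ≤ τ → 0 ≤ C →
      (∀ N, ∀ t ∈ Icc 0 τ, |f N t| ≤ B) → (∀ N, Measurable (f N)) →
      (∀ N, ∀ t ∈ Icc 0 τ, f N t ≤ f N 0 + C * (∫ s in (0:ℝ)..t, f N s) + err N t) →
      (∀ t ∈ Icc 0 τ, Tendsto (fun N => err N t) atTop (𝓝 0)) →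
      Tendsto (fun N => f N 0) atTop (𝓝 0) →
      ∀ t ∈ Icc 0 τ, ∀ ε > (0:ℝ), ∀ᶠ N in atTop, f N t ≤ ε) →
    (∀ (ε : ℝ) (n : ℕ) (Φ : HardSphereFlow (Literature.Analysis.FluidPDE.Torus.geometry (Fin 3)) ε n),
      ∃ Ψ : ℝ × Config n (Fin 3) T3 → Config n (Fin 3) T3, Measurable Ψ ∧
        ∀ (t : ℝ), ∀ z ∈ Φ.good, Ψ (t, z) = Φ.flow t z) →
    (∀ σ : ℝ, 0 < σ → ∀ (N : ℕ)
      (Φ : HardSphereFlow (Literature.Analysis.FluidPDE.Torus.geometry (Fin 3)) (hsDiameter σ N) (N + 1))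
      (l : ℝ), 0 < l → l ≤ 1 → ∀ z ∈ Φ.good, BoxBalanceLawsFor σ N Φ l z) →
    (HsEosLowDensity →
      ∃ ηm : ℝ, 0 < ηm ∧ ∀ η₁ : ℝ, 0 < η₁ → η₁ < ηm → ∀ σ : ℝ, 0 < σ → CutEosMasterFor σ η₁) →
    (∀ (a₀ θ₀ : T3 → ℝ) (u₀ : T3 → V3), Continuous a₀ → Continuous θ₀ → Continuous u₀ →
      (∀ x, 0 < a₀ x) → (∀ x, 0 < θ₀ x) → EnergyMomentFor a₀ u₀ θ₀) →
    FluxClosure → EntropyAdmissibility → HsEosLowDensity →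
      ∃ ηb : ℝ, 0 < ηb ∧ ∀ η₁ : ℝ, 0 < η₁ → η₁ < ηb →
        ∀ (a₀ θ₀ : T3 → ℝ) (u₀ : T3 → V3), Continuous a₀ → Continuous θ₀ → Continuous u₀ →
          (∀ x, 0 < a₀ x) → (∀ x, 0 < θ₀ x) →
          ∃ σ₀ : ℝ, 0 < σ₀ ∧ ∀ σ : ℝ, 0 < σ → σ < σ₀ →
            ∀ (T : ℝ) (ρ θ : ℝ → T3 → ℝ) (u : ℝ → T3 → V3), IsHardSphereEulerSolution σ T ρ u θ →
              (∀ t ∈ Ico 0 T, ∀ x, ρ t x * σ ^ 3 ≤ η₁ / 2) →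
              ∀ Φ : (N : ℕ) → HardSphereFlow (Literature.Analysis.FluidPDE.Torus.geometry (Fin 3))
                  (hsDiameter σ N) (N + 1),
                TendstoHydroFieldsAt (fun N => localGibbsLaw σ a₀ u₀ θ₀ N (Φ N)) Φ ρ u θ 0 →
                  ∀ ℓ : ℕ → ℝ, IsKineticWindow ℓ →
                    ∀ τ ∈ Ico 0 T, ∀ a b : ℝ, ClampAdmissible σ η₁ a b ρ θ τ →
                      BoxClampedRelEnergyVanishesAt σ η₁ a b a₀ u₀ θ₀ Φ ρ u θ ℓ 0 →
                        BoxClampedRelEnergyVanishesAt σ η₁ a b a₀ u₀ θ₀ Φ ρ u θ ℓ τ := by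
  intro hG hJ hB hM hE hFC hEA hEos
  -- thresholds
  obtain ⟨ηc1, hηc1, hK1⟩ := sx_fluxClosure_velocity hFC hEos
  obtain ⟨ηc2, hηc2, hK2⟩ := sx_entropyAdmissibility_temperature hEA hEos
  obtain ⟨ηm, hηm, hHM⟩ := hM hEos
  obtain ⟨η₀, hη₀, F, hFan, hFeq, -⟩ := hEos
  obtain ⟨ηd, hηd, -, hco⟩ := co_pointwise_estimate hη₀ hFan hFeq
  obtain ⟨η₁B, hη₁B, h2B, hext⟩ := cm_band_extension hη₀ hFan hFeq
  obtain ⟨ηe, hηe, hsmall⟩ := sx_smallness hη₀ hFan hFeq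
  refine ⟨min (min (min ηc1 ηc2) (min ηm ηd)) (min η₁B ηe), by positivity, ?_⟩
  intro η₁ hη₁ hη₁b a₀ θ₀ u₀ ha hθ hu ha0 hθ0
  have hη₁c1 : η₁ < ηc1 := hη₁b.trans_le ((min_le_left _ _).trans ((min_le_left _ _).trans (min_le_left _ _)))
  have hη₁c2 : η₁ < ηc2 := hη₁b.trans_le ((min_le_left _ _).trans ((min_le_left _ _).trans (min_le_right _ _)))
  have hη₁m : η₁ < ηm := hη₁b.trans_le ((min_le_left _ _).trans ((min_le_right _ _).trans (min_le_left _ _)))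
  have hη₁d' : η₁ < ηd := hη₁b.trans_le ((min_le_left _ _).trans ((min_le_right _ _).trans (min_le_right _ _)))
  have hη₁B' : η₁ ≤ η₁B := (hη₁b.trans_le ((min_le_right _ _).trans (min_le_left _ _))).le
  have hη₁e : η₁ < ηe := hη₁b.trans_le ((min_le_right _ _).trans (min_le_right _ _))
  obtain ⟨hW', hZ1, hZpos⟩ := hsmall η₁ hη₁ hη₁e
  obtain ⟨σ₁, hσ₁, hK1'⟩ := hK1 η₁ hη₁ hη₁c1 a₀ θ₀ u₀ ha hθ hu ha0 hθ0
  obtain ⟨σ₂, hσ₂, hK2'⟩ := hK2 η₁ hη₁ hη₁c2 a₀ θ₀ u₀ ha hθ hu ha0 hθ0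
  obtain ⟨CE, hCE, hEM⟩ := hE a₀ θ₀ u₀ ha hθ hu ha0 hθ0
  refine ⟨min (1 / 2) (min σ₁ σ₂), by positivity, ?_⟩
  intro σ hσ hσ0 T ρ θ u hsol hguard Φ hLLN ℓ hℓw τ hτ a b hadm hV0
  have hσ2 : σ ≤ 1 / 2 := (hσ0.trans_le (min_le_left _ _)).le
  have hσσ₁ : σ < σ₁ := hσ0.trans_le ((min_le_right _ _).trans (min_le_left _ _))
  have hσσ₂ : σ < σ₂ := hσ0.trans_le ((min_le_right _ _).trans (min_le_right _ _))
  obtain ⟨χ, f, hχ2, hf2, hvir, -, -, hagree⟩ := hext σ hσ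
  have hGB : (EulerEOS.monatomicExcess χ f).IsGibbs :=
    monatomicExcess_isGibbs χ f (hχ2.of_le one_le_two) (hf2.of_le one_le_two) hvir
  have S : AnalyticOnNhd ℝ F (Ioo (-η₀) η₀) ∧ EqOn hsExcessFreeEnergy F (Ico 0 η₀) ∧ 0 < η₁ ∧ η₁ ≤ η₁B ∧
      2 * η₁B < η₀ ∧ 0 < σ ∧
      (∀ x, 0 < x → x * σ ^ 3 ≤ η₁B → f x = hsExcessFreeEnergy (x * σ ^ 3) ∧ χ x = hsCompressibility (x * σ ^ 3)) ∧
      (EulerEOS.monatomicExcess χ f).IsGibbs ∧ IsHardSphereEulerSolution σ T ρ u θ ∧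
      ∀ t ∈ Ico 0 T, ∀ x, ρ t x * σ ^ 3 ≤ η₁ / 2 :=
    ⟨hFan, hFeq, hη₁, hη₁B', h2B, hσ, hagree, hGB, hsol, hguard⟩
  have hT : 0 < T := hτ.1.trans_lt hτ.2
  have hℓ : ∀ N, 0 < ℓ N ∧ ℓ N ≤ 1 := hℓw.1
  have hIcc : Icc 0 τ ⊆ Ico 0 T := fun t ht => ⟨ht.1, ht.2.trans_lt hτ.2⟩
  have hab : a ≤ b := hadm.1.le
  -- the local Gibbs laws are probability measures
  haveI hP : ∀ N, IsProbabilityMeasure (localGibbsLaw σ a₀ u₀ θ₀ N (Φ N)) := fun N =>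
    isProbabilityMeasure_localGibbsLaw ha hθ hu ha0 hθ0 hσ2 N (Φ N)
  -- jointly measurable versions of the flows
  choose Ψ hΨm hΨeq using fun N => hJ (hsDiameter σ N) (N + 1) (Φ N)
  -- sharp domination, master constant, nonnegativity scales
  obtain ⟨A, Bc, hA, hBc, hAB⟩ := sx_obs_abs_le S hτ hab
  have hABz : ∀ N, ∀ z ∈ (Φ N).good, ∀ s ∈ Icc 0 τ,
      |clampedRelEnergyObs σ η₁ a b ρ u θ N (Φ N) (ℓ N) s z| ≤ A + Bc * (((N : ℝ) + 1)⁻¹ * configEnergy z) :=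
    fun N z hz s hs => hAB N (Φ N) (ℓ N) z (hB σ hσ N (Φ N) (ℓ N) (hℓ N).1 (hℓ N).2 z hz) s hs
  obtain ⟨C, ρs, hC0, hρs, hmaster⟩ := sx_master_constant S (hHM η₁ hη₁ hη₁m σ hσ) hW' hZ1 hZpos hτ hadm
  obtain ⟨ρs0, hρs0, hco0⟩ := hco η₁ hη₁ hη₁d' σ hσ T ρ θ u hsol 0 ⟨le_rfl, hT⟩ a b (clampAdmissible_mono hadm hτ.1)
  obtain ⟨ρsτ, hρsτ, hcoτ⟩ := hco η₁ hη₁ hη₁d' σ hσ T ρ θ u hsol τ hτ a b hadm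
  obtain ⟨K0, -, hP0⟩ := hco0 1 one_pos
  obtain ⟨Kτ, -, hPτ⟩ := hcoτ 1 one_pos
  -- the threshold `N₀`
  obtain ⟨N₀, hN₀⟩ := eventually_atTop.1 (sx_window_eventually hℓw (lt_min hρs (lt_min hρs0 hρsτ)))
  -- a.e.: good data with pairwise distinct velocities at rational times
  have hae : ∀ N, ∀ᵐ z ∂(localGibbsLaw σ a₀ u₀ θ₀ N (Φ N)), z ∈ (Φ N).good ∧
      ∀ q : ℚ, ∀ i j, i ≠ j → ((Φ N).flow (q : ℝ) z i).2 ≠ ((Φ N).flow (q : ℝ) z j).2 :=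
    fun N => sx_ae_rational_distinct N (Φ N)
  -- integrability of the observable and of its time integral, Fubini, measurability of the mean
  have hint : ∀ N, ∀ s ∈ Icc 0 τ, Integrable (fun z => clampedRelEnergyObs σ η₁ a b ρ u θ N (Φ N) (ℓ N) s z)
      (localGibbsLaw σ a₀ u₀ θ₀ N (Φ N)) := fun N s hs =>
    sx_integrable_obs S ha hθ hu ha0 hθ0 hσ2 (Φ N) (hΨm N) (hΨeq N) (hℓ N).1 hab hτ (hABz N) hs
  have hintI : ∀ N, ∀ t ∈ Icc 0 τ, Integrable
      (fun z => ∫ s in Ioc 0 t, clampedRelEnergyObs σ η₁ a b ρ u θ N (Φ N) (ℓ N) s z)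
      (localGibbsLaw σ a₀ u₀ θ₀ N (Φ N)) := fun N t ht =>
    sx_integrable_timeIntegral_obs S ha hθ hu ha0 hθ0 hσ2 (Φ N) (hΨm N) (hΨeq N) (hℓ N).1 hab hτ (hABz N) ht
  -- the Grönwall function
  obtain ⟨fN, hfN⟩ : ∃ fN : ℕ → ℝ → ℝ, fN = fun N t => ∫ z, (∫ x,
      clampedRelEnergy σ η₁ a b (ρ (max 0 (min t τ)) x) (u (max 0 (min t τ)) x) (θ (max 0 (min t τ)) x)
        (boxState (ℓ N) (Ψ N (max 0 (min t τ), z)) x)) ∂(localGibbsLaw σ a₀ u₀ θ₀ N (Φ N)) := ⟨_, rfl⟩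
  have hfN_eq : ∀ N, ∀ t ∈ Icc 0 τ,
      fN N t = ∫ z, clampedRelEnergyObs σ η₁ a b ρ u θ N (Φ N) (ℓ N) t z ∂(localGibbsLaw σ a₀ u₀ θ₀ N (Φ N)) := by
    intro N t ht
    rw [hfN]
    refine integral_congr_ae ((hae N).mono fun z hz => ?_)
    exact ex_obsPsi_eq (Φ N) (hΨeq N) (ℓ N) a b hz.1 ht
  have hfubini : ∀ N, ∀ t ∈ Icc 0 τ,
      ∫ z, (∫ s in Ioc 0 t, clampedRelEnergyObs σ η₁ a b ρ u θ N (Φ N) (ℓ N) s z) ∂(localGibbsLaw σ a₀ u₀ θ₀ N (Φ N)) =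
        ∫ s in (0:ℝ)..t, fN N s := by
    intro N t ht
    rw [intervalIntegral.integral_of_le ht.1, hfN]
    exact sx_fubini_obs S ha hθ hu ha0 hθ0 hσ2 (Φ N) (hΨm N) (hΨeq N) (hℓ N).1 hab hτ (hABz N) ht
  -- nonnegativity at times `0` and `τ` beyond the threshold
  have hnonneg : ∀ N, N₀ ≤ N → ∀ s, (s = 0 ∨ s = τ) →
      0 ≤ᵐ[localGibbsLaw σ a₀ u₀ θ₀ N (Φ N)] fun z => clampedRelEnergyObs σ η₁ a b ρ u θ N (Φ N) (ℓ N) s z := by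
    intro N hN s hs
    have hth := hN₀ N hN
    filter_upwards [hae N] with z hz
    have hdist := ad_distinct_of_rational (Φ N) hz.1 hz.2 s
    rcases hs with rfl | rfl
    · exact sx_obs_nonneg (fun x U h1 h2 h3 h4 => (hP0 x U h1 h2 h3 h4).1) (hℓ N).1.le _ hdist
        (hth.trans ((min_le_right _ _).trans (min_le_left _ _)))
    · exact sx_obs_nonneg (fun x U h1 h2 h3 h4 => (hPτ x U h1 h2 h3 h4).1) (hℓ N).1.le _ hdist
        (hth.trans ((min_le_right _ _).trans (min_le_right _ _)))
  -- (a) uniform bound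
  have hKE0 : ∀ (n : ℕ) (z : Config n (Fin 3) T3), 0 ≤ configEnergy z := fun n z => by
    unfold configEnergy; positivity
  have hbound : ∀ N, ∀ t ∈ Icc 0 τ, |fN N t| ≤ A + Bc * CE.toReal := by
    intro N t ht
    rw [hfN_eq N t ht]
    have hdom := ex_integrable_dom ha hθ hu ha0 hθ0 hσ2 (Φ N) A Bc
    have h1 : ‖∫ z, clampedRelEnergyObs σ η₁ a b ρ u θ N (Φ N) (ℓ N) t z ∂(localGibbsLaw σ a₀ u₀ θ₀ N (Φ N))‖ ≤
        ∫ z, (A + Bc * (((N : ℝ) + 1)⁻¹ * configEnergy z)) ∂(localGibbsLaw σ a₀ u₀ θ₀ N (Φ N)) :=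
      norm_integral_le_of_norm_le hdom ((hae N).mono fun z hz => by
        rw [Real.norm_eq_abs]; exact hABz N z hz.1 t ht)
    rw [Real.norm_eq_abs] at h1
    refine h1.trans ?_
    have hKEi : Integrable (fun z : Config (N + 1) (Fin 3) T3 => ((N : ℝ) + 1)⁻¹ * configEnergy z)
        (localGibbsLaw σ a₀ u₀ θ₀ N (Φ N)) :=
      (EABirthS1a.integrable_configEnergy_localGibbsLaw ha hθ hu (fun x => (ha0 x).le) hθ0 σ N (Φ N)).const_mul _
    rw [integral_add (integrable_const A) (hKEi.const_mul Bc), integral_const, integral_const_mul]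
    simp only [Measure.real, measure_univ, ENNReal.toReal_one, one_smul]
    have h2 : ∫ z, ((N : ℝ) + 1)⁻¹ * configEnergy z ∂(localGibbsLaw σ a₀ u₀ θ₀ N (Φ N)) ≤ CE.toReal := by
      rw [integral_eq_lintegral_of_nonneg_ae (ae_of_all _ fun z => by positivity [hKE0 _ z])
        hKEi.aestronglyMeasurable]
      exact ENNReal.toReal_mono hCE (hEM σ hσ N (Φ N)).2
    nlinarith [h2, hBc]
  -- (b) measurability
  have hmeas : ∀ N, Measurable (fN N) := fun N => by
    rw [hfN]; exact sx_measurable_mean S ha hθ hu ha0 hθ0 hσ2 (Φ N) (hΨm N) (hℓ N).1 a b hτ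
  -- (c) `f_N(0) → 0`
  have hf0 : Tendsto (fun N => fN N 0) atTop (𝓝 0) := by
    have hlim := (ENNReal.tendsto_toReal ENNReal.zero_ne_top).comp hV0
    rw [ENNReal.toReal_zero] at hlim
    refine hlim.congr' ?_
    filter_upwards [eventually_ge_atTop N₀] with N hN
    rw [Function.comp_apply, hfN_eq N 0 ⟨le_rfl, hτ.1⟩,
      integral_eq_lintegral_of_nonneg_ae (hnonneg N hN 0 (Or.inl rfl)) (hint N 0 ⟨le_rfl, hτ.1⟩).aestronglyMeasurable]
  -- the K1 / K2 functionals (opaque names with defining equations)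
  obtain ⟨K1a, hK1a⟩ : ∃ K1a : (N : ℕ) → ℝ → Config (N + 1) (Fin 3) T3 → ℝ, K1a = fun N t z =>
      (|(∫ x, inner ℝ (boxState (ℓ N) ((Φ N).flow t z) x).2.1 (u t x)) -
                            (∫ x, inner ℝ (boxState (ℓ N) ((Φ N).flow 0 z) x).2.1 (u 0 x)) -
                            ∫ s in Ioc 0 t, ∫ x,
                              (inner ℝ (boxState (ℓ N) ((Φ N).flow s z) x).2.1
                                  (Torus.timeDerivWithin (Ico 0 T) u s x) +
                                (∑ i, ∑ j, (boxState (ℓ N) ((Φ N).flow s z) x).2.1 i *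
                                    (boxState (ℓ N) ((Φ N).flow s z) x).2.1 j /
                                    (boxState (ℓ N) ((Φ N).flow s z) x).1 *
                                  Torus.partialDeriv j (fun y => u s y i) x) +
                                (boxState (ℓ N) ((Φ N).flow s z) x).1 *
                                    (2 / 3 * ((boxState (ℓ N) ((Φ N).flow s z) x).2.2 /
                                        (boxState (ℓ N) ((Φ N).flow s z) x).1 -
                                      ‖(boxState (ℓ N) ((Φ N).flow s z) x).2.1‖ ^ 2 /
                                        (2 * (boxState (ℓ N) ((Φ N).flow s z) x).1 ^ 2))) *
                                    cutCompressibility η₁ ((boxState (ℓ N) ((Φ N).flow s z) x).1 * σ ^ 3) *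
                                  Torus.divergence (u s) x)|) := ⟨_, rfl⟩
  obtain ⟨K2f, hK2f⟩ : ∃ K2f : (N : ℕ) → ℝ → Config (N + 1) (Fin 3) T3 → ℝ, K2f = fun N t z =>
      ((∫ s in Ioc 0 t, ∫ x,
                              ((boxState (ℓ N) ((Φ N).flow s z) x).1 *
                                    max a (min ((cutEOS σ η₁).s (boxState (ℓ N) ((Φ N).flow s z) x).1
                                      (2 / 3 * ((boxState (ℓ N) ((Φ N).flow s z) x).2.2 /
                                          (boxState (ℓ N) ((Φ N).flow s z) x).1 -
                                        ‖(boxState (ℓ N) ((Φ N).flow s z) x).2.1‖ ^ 2 /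
                                          (2 * (boxState (ℓ N) ((Φ N).flow s z) x).1 ^ 2)))) b) *
                                  Torus.timeDerivWithin (Ico 0 T) θ s x +
                                max a (min ((cutEOS σ η₁).s (boxState (ℓ N) ((Φ N).flow s z) x).1
                                      (2 / 3 * ((boxState (ℓ N) ((Φ N).flow s z) x).2.2 /
                                          (boxState (ℓ N) ((Φ N).flow s z) x).1 -
                                        ‖(boxState (ℓ N) ((Φ N).flow s z) x).2.1‖ ^ 2 /
                                          (2 * (boxState (ℓ N) ((Φ N).flow s z) x).1 ^ 2)))) b) *
                                  inner ℝ (boxState (ℓ N) ((Φ N).flow s z) x).2.1 (Torus.gradient (θ s) x))) -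
                            (∫ x, (boxState (ℓ N) ((Φ N).flow t z) x).1 *
                                max a (min ((cutEOS σ η₁).s (boxState (ℓ N) ((Φ N).flow t z) x).1
                                  (2 / 3 * ((boxState (ℓ N) ((Φ N).flow t z) x).2.2 /
                                      (boxState (ℓ N) ((Φ N).flow t z) x).1 -
                                    ‖(boxState (ℓ N) ((Φ N).flow t z) x).2.1‖ ^ 2 /
                                      (2 * (boxState (ℓ N) ((Φ N).flow t z) x).1 ^ 2)))) b) * θ t x) +
                            (∫ x, (boxState (ℓ N) ((Φ N).flow 0 z) x).1 *
                                max a (min ((cutEOS σ η₁).s (boxState (ℓ N) ((Φ N).flow 0 z) x).1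
                                  (2 / 3 * ((boxState (ℓ N) ((Φ N).flow 0 z) x).2.2 /
                                      (boxState (ℓ N) ((Φ N).flow 0 z) x).1 -
                                    ‖(boxState (ℓ N) ((Φ N).flow 0 z) x).2.1‖ ^ 2 /
                                      (2 * (boxState (ℓ N) ((Φ N).flow 0 z) x).1 ^ 2)))) b) * θ 0 x)) := ⟨_, rfl⟩
  have hK1t : ∀ t ∈ Ico 0 T,
      Tendsto (fun N => ∫⁻ z, ENNReal.ofReal (K1a N t z) ∂(localGibbsLaw σ a₀ u₀ θ₀ N (Φ N))) atTop (𝓝 0) := by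
    intro t ht; rw [hK1a]; exact hK1' σ hσ hσσ₁ T ρ θ u hsol hguard Φ hLLN ℓ hℓw t ht
  have hK2t : ∀ t ∈ Ico 0 T,
      Tendsto (fun N => ∫⁻ z, ENNReal.ofReal (K2f N t z) ∂(localGibbsLaw σ a₀ u₀ θ₀ N (Φ N))) atTop (𝓝 0) := by
    intro t ht; rw [hK2f]; exact hK2' σ hσ hσσ₂ T ρ θ u hsol hguard Φ hLLN ℓ hℓw t ht a b hadm.1
  have hcont : ContinuousOn hsExcessFreeEnergy (Ico 0 η₀) := sx_continuousOn_hsExcess hFan hFeq hη₀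
  have hη₁₀ : η₁ < η₀ := sx_band_lt S
  have hK1m : ∀ N, ∀ t ∈ Ico 0 T, AEMeasurable (K1a N t) (localGibbsLaw σ a₀ u₀ θ₀ N (Φ N)) := by
    intro N t ht; rw [hK1a]; exact sx_aemeasurable_K1 hsol.smooth_velocity a₀ θ₀ u₀ Φ ℓ hℓ N ht
  have hK2m : ∀ N, ∀ t ∈ Ico 0 T, AEMeasurable (K2f N t) (localGibbsLaw σ a₀ u₀ θ₀ N (Φ N)) := by
    intro N t ht; rw [hK2f]
    exact sx_aemeasurable_K2 hcont hσ hσ2 hη₁ hη₁₀ hsol.smooth_temperature ha hθ hu ha0 hθ0 Φ ℓ hℓ N hab ht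
  have hK1nn : ∀ N t z, 0 ≤ K1a N t z := by intro N t z; rw [hK1a]; exact abs_nonneg _
  -- the pathwise inequality, a.s., beyond the threshold
  have hpath : ∀ N, N₀ ≤ N → ∀ t ∈ Icc 0 τ, ∀ᵐ z ∂(localGibbsLaw σ a₀ u₀ θ₀ N (Φ N)),
      clampedRelEnergyObs σ η₁ a b ρ u θ N (Φ N) (ℓ N) t z - clampedRelEnergyObs σ η₁ a b ρ u θ N (Φ N) (ℓ N) 0 z ≤
        C * (∫ s in Ioc 0 t, clampedRelEnergyObs σ η₁ a b ρ u θ N (Φ N) (ℓ N) s z) + K1a N t z +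
          max (K2f N t z) 0 := by
    intro N hN t ht
    have hth : ((N : ℝ) + 1)⁻¹ * (ℓ N ^ 3)⁻¹ ≤ ρs := (hN₀ N hN).trans (min_le_left _ _)
    filter_upwards [hae N] with z hz
    rw [hK1a, hK2f]
    exact sx_pathwise S Φ ℓ hℓ N hz.1 hz.2 (hB σ hσ N (Φ N) (ℓ N) (hℓ N).1 (hℓ N).2 z hz.1) hab (hIcc ht) hth
      fun s hs x v hv => hmaster s ⟨hs.1, hs.2.trans ht.2⟩ x v hv
  -- the forcing
  obtain ⟨errN, herrN⟩ : ∃ errN : ℕ → ℝ → ℝ, errN = fun N t =>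
      if N₀ ≤ N ∧ (∫⁻ z, ENNReal.ofReal (K1a N t z) ∂(localGibbsLaw σ a₀ u₀ θ₀ N (Φ N))) ≠ ∞ ∧
          (∫⁻ z, ENNReal.ofReal (K2f N t z) ∂(localGibbsLaw σ a₀ u₀ θ₀ N (Φ N))) ≠ ∞ then
        (∫⁻ z, ENNReal.ofReal (K1a N t z) ∂(localGibbsLaw σ a₀ u₀ θ₀ N (Φ N))).toReal +
          (∫⁻ z, ENNReal.ofReal (K2f N t z) ∂(localGibbsLaw σ a₀ u₀ θ₀ N (Φ N))).toReal
      else fN N t - fN N 0 - C * ∫ s in (0:ℝ)..t, fN N s := ⟨_, rfl⟩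
  -- (d) the integral inequality
  have hineq : ∀ N, ∀ t ∈ Icc 0 τ, fN N t ≤ fN N 0 + C * (∫ s in (0:ℝ)..t, fN N s) + errN N t := by
    intro N t ht
    rw [herrN]
    dsimp only
    split_ifs with hcase
    · obtain ⟨hN, h1fin, h2fin⟩ := hcase
      have ht' : t ∈ Ico 0 T := hIcc ht
      have h0 : (0 : ℝ) ∈ Icc 0 τ := ⟨le_rfl, hτ.1⟩
      have hK1i : Integrable (K1a N t) (localGibbsLaw σ a₀ u₀ θ₀ N (Φ N)) :=
        ⟨(hK1m N t ht').aestronglyMeasurable,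
          (hasFiniteIntegral_iff_ofReal (ae_of_all _ (hK1nn N t))).2 (lt_top_iff_ne_top.2 h1fin)⟩
      have hmax : ∫⁻ z, ENNReal.ofReal (max (K2f N t z) 0) ∂(localGibbsLaw σ a₀ u₀ θ₀ N (Φ N)) =
          ∫⁻ z, ENNReal.ofReal (K2f N t z) ∂(localGibbsLaw σ a₀ u₀ θ₀ N (Φ N)) :=
        lintegral_congr fun z => by
          rcases le_total (K2f N t z) 0 with h | h
          · rw [max_eq_right h, ENNReal.ofReal_zero, ENNReal.ofReal_of_nonpos h]
          · rw [max_eq_left h]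
      have hK2m' : AEMeasurable (fun z => max (K2f N t z) 0) (localGibbsLaw σ a₀ u₀ θ₀ N (Φ N)) :=
        (hK2m N t ht').max aemeasurable_const
      have hK2i : Integrable (fun z => max (K2f N t z) 0) (localGibbsLaw σ a₀ u₀ θ₀ N (Φ N)) := by
        refine ⟨hK2m'.aestronglyMeasurable, ?_⟩
        rw [hasFiniteIntegral_iff_ofReal (f := fun z => max (K2f N t z) 0)
          (ae_of_all _ fun z => (le_max_right (K2f N t z) 0 : (0 : ℝ) ≤ max (K2f N t z) 0)), hmax]
        exact lt_top_iff_ne_top.2 h2fin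
      have hIi := (hintI N t ht).const_mul C
      have hmono := integral_mono_ae ((hint N t ht).sub (hint N 0 h0)) ((hIi.add hK1i).add hK2i) (hpath N hN t ht)
      simp only [Pi.add_apply, Pi.sub_apply] at hmono
      have i1 := integral_sub (hint N t ht) (hint N 0 h0)
      have i2 := integral_add (hIi.add hK1i) hK2i
      have i3 := integral_add hIi hK1i
      simp only [Pi.add_apply] at i2 i3
      have i4 : ∫ z, C * (∫ s in Ioc 0 t, clampedRelEnergyObs σ η₁ a b ρ u θ N (Φ N) (ℓ N) s z)
          ∂(localGibbsLaw σ a₀ u₀ θ₀ N (Φ N)) = C * ∫ s in (0:ℝ)..t, fN N s := by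
        rw [integral_const_mul, hfubini N t ht]
      have i5 : ∫ z, K1a N t z ∂(localGibbsLaw σ a₀ u₀ θ₀ N (Φ N)) =
          (∫⁻ z, ENNReal.ofReal (K1a N t z) ∂(localGibbsLaw σ a₀ u₀ θ₀ N (Φ N))).toReal :=
        integral_eq_lintegral_of_nonneg_ae (ae_of_all _ (hK1nn N t)) hK1i.aestronglyMeasurable
      have i6 : ∫ z, max (K2f N t z) 0 ∂(localGibbsLaw σ a₀ u₀ θ₀ N (Φ N)) =
          (∫⁻ z, ENNReal.ofReal (K2f N t z) ∂(localGibbsLaw σ a₀ u₀ θ₀ N (Φ N))).toReal := by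
        rw [integral_eq_lintegral_of_nonneg_ae (f := fun z => max (K2f N t z) 0)
          (ae_of_all _ fun z => (le_max_right (K2f N t z) 0 : (0 : ℝ) ≤ max (K2f N t z) 0)) hK2i.aestronglyMeasurable,
          hmax]
      rw [i1, i2, i3, i4, i5, i6, ← hfN_eq N t ht, ← hfN_eq N 0 h0] at hmono
      linarith
    · linarith
  -- (e) the forcing vanishes
  have herr : ∀ t ∈ Icc 0 τ, Tendsto (fun N => errN N t) atTop (𝓝 0) := by
    intro t ht
    have ht' : t ∈ Ico 0 T := hIcc ht
    have hlim := (((ENNReal.tendsto_toReal ENNReal.zero_ne_top).comp (hK1t t ht')).add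
      ((ENNReal.tendsto_toReal ENNReal.zero_ne_top).comp (hK2t t ht')))
    rw [ENNReal.toReal_zero, add_zero] at hlim
    refine hlim.congr' ?_
    have h1 : ∀ᶠ N in atTop, (∫⁻ z, ENNReal.ofReal (K1a N t z) ∂(localGibbsLaw σ a₀ u₀ θ₀ N (Φ N))) < 1 :=
      (hK1t t ht').eventually (gt_mem_nhds zero_lt_one)
    have h2 : ∀ᶠ N in atTop, (∫⁻ z, ENNReal.ofReal (K2f N t z) ∂(localGibbsLaw σ a₀ u₀ θ₀ N (Φ N))) < 1 :=
      (hK2t t ht').eventually (gt_mem_nhds zero_lt_one)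
    filter_upwards [h1, h2, eventually_ge_atTop N₀] with N hN1 hN2 hN
    rw [herrN]
    dsimp only
    rw [if_pos ⟨hN, (hN1.trans ENNReal.one_lt_top).ne, (hN2.trans ENNReal.one_lt_top).ne⟩]
    rfl
  -- (f) forced Grönwall
  have hGτ := hG fN errN τ C (A + Bc * CE.toReal) hτ.1 hC0 hbound hmeas hineq herr hf0 τ ⟨hτ.1, le_rfl⟩
  -- (g) back to the clamped vanishing at `τ`
  have hτI : τ ∈ Icc 0 τ := ⟨hτ.1, le_rfl⟩
  have hfτ0 : ∀ᶠ N in atTop, 0 ≤ fN N τ := by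
    filter_upwards [eventually_ge_atTop N₀] with N hN
    rw [hfN_eq N τ hτI]
    exact integral_nonneg_of_ae (hnonneg N hN τ (Or.inr rfl))
  have hfτ : Tendsto (fun N => fN N τ) atTop (𝓝 0) := sx_tendsto_zero_of_eventually_le hfτ0 hGτ
  have hlim := ENNReal.tendsto_ofReal hfτ
  rw [ENNReal.ofReal_zero] at hlim
  refine hlim.congr' ?_
  filter_upwards [eventually_ge_atTop N₀] with N hN
  rw [hfN_eq N τ hτI, ofReal_integral_eq_lintegral_ofReal (hint N τ hτI) (hnonneg N hN τ (Or.inr rfl))]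

end Summit.AtomisticToContinuum.HydrodynamicLimit.Theorems.RES

end
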